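import Literature.Geometry.Riemannian.BakryEmeryHeatFlow
import Literature.Geometry.Lorentzian.CurvatureRegularity
import Literature.Geometry.Riemannian.RicciFlowScalarCurvatureProofs
import Literature.Geometry.Lorentzian.VolumePositivity
import HarnessLib

/-!
# Entropy ≥ log-volume under `Ric ≥ 3g`, from the entropy–energy inequality EE(3,4)
(stub `stub_entropyVolume_of_entropyEnergy` of line `curvature-dimension-entropy-floor`, crux
`EntropyRung.SubcylindricalExistence`, item stmt-SmoothPoincare4-10871)

THEOREM A of the line (Statement C): on a closed connected Riemannian 4-manifold `(M, g)` (`g`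
with Levi-Civita connection) with `Ric ≥ 3g`, for every `τ > 0` and every smooth `f` with
`∫ (4πτ)⁻² e^{-f} dV = 1`,

  `log Vol(M,g) − 2 log(2π/3) − 2 ≤ 𝒲(g,f,τ) = ∫ [τ(R + |∇f|²) + f − 4] (4πτ)⁻² e^{-f} dV`,

ASSUMING the curvature–dimension entropy–energy inequality EE(3,4) (Statement B of the line,
Bakry–Gentil–Ledoux 2014, §6; Bakry–Bolley–Gentil, arXiv:1412.5165, eq. (4.1)): for every smooth `w`
with `∫ w² dV = Vol`, `(1/Vol) ∫ w² log w² dV ≤ 2 log(1 + ∫|∇w|² dV/(3 Vol))`.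

Proof (pure rewriting plus one real-variable inequality). Put `V = Vol(M,g)` (positive and finite),
`A = (4πτ)⁻²`, `u = A e^{-f}` (`∫ u dV = 1`) and `w = √(V A) e^{-f/2}`: `w² = V u`, so
`∫ w² dV = V`, `|∇w|² = ¼ V u |∇f|²` (chain rule), `w² log w² = V u (log V + log A − f)`. EE(3,4)
becomes `log V + log A − ∫ f u ≤ 2 log(1 + ∫ |∇f|² u/12)`. With `R = tr Ric ≥ 12`
(`scalarCurvature_ge_four_mul_of_ricci_ge`) the entropy splits as
`𝒲 = τ ∫ R u + τ ∫ |∇f|² u + ∫ f u − 4 ≥ 12τ + τ G + log V + log A − 2 log(1 + G/12) − 4`,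
`G = ∫ |∇f|² u ≥ 0`, and the one-variable inequality `τ G − 2 log(1 + G/12) ≥ 2 − 12τ + 2 log(6τ)`
(`log y ≤ y − 1` at `y = 6τ(1 + G/12)`, `entropyEnergy_oneVariable`) together with
`log A + 2 log(6τ) = −2 log(2π/3)` (`log_normaliser_add`) makes every `τ` cancel.

Everything is proved; no definition, no named fact.

References: D. Bakry, I. Gentil, M. Ledoux, *Analysis and geometry of Markov diffusion operators*
(2014), §6 [BakryGentilLedoux2014]; D. Bakry, F. Bolley, I. Gentil, arXiv:1412.5165, §4.1,
eq. (4.1); B. O'Neill, *Semi-Riemannian geometry* (1983), Ch. 3, Def. 3.53 [ONeill1983].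
-/

noncomputable section

-- the registered namespace `Summit.SmoothPoincare4.SmoothPoincare4.Theorems` repeats a component
set_option linter.dupNamespace false

open Bundle Set Function Filter Module MeasureTheory
open scoped Manifold ContDiff Topology ENNReal

namespace Summit.SmoothPoincare4.SmoothPoincare4.Theorems

open Literature.Geometry Literature.Geometry.Lorentzian Literature.Geometry.Riemannian

namespace EntropyVolume

/-! ## Real-variable lemmas -/

/-- **The one-variable inequality behind the `τ`-cancellation**: for `0 < τ` and `0 ≤ G`,
`2 − 12τ + 2 log(6τ) ≤ τ G − 2 log(1 + G/12)` (`log y ≤ y − 1` at `y = 6τ(1 + G/12)`; equality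
iff `6τ(1 + G/12) = 1`). [folklore] -/
theorem entropyEnergy_oneVariable {τ G : ℝ} (hτ : 0 < τ) (hG : 0 ≤ G) :
    2 - 12 * τ + 2 * Real.log (6 * τ) ≤ τ * G - 2 * Real.log (1 + G / 12) := by
  have h6 : 0 < 6 * τ := by positivity
  have h1 : 0 < 1 + G / 12 := by positivity
  have hy := Real.log_le_sub_one_of_pos (mul_pos h6 h1)
  rw [Real.log_mul h6.ne' h1.ne',
    show 6 * τ * (1 + G / 12) = 6 * τ + τ * G / 2 by ring] at hy
  linarith

/-- **The normalisation constants**: `log (4πτ)^{-4/2} + 2 log(6τ) = −2 log(2π/3)` for `τ > 0`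
(`4πτ = (2π/3)(6τ)`). [folklore] -/
theorem log_normaliser_add {τ : ℝ} (hτ : 0 < τ) :
    Real.log ((4 * Real.pi * τ) ^ (-(4 : ℝ) / 2)) + 2 * Real.log (6 * τ) =
      -(2 * Real.log (2 * Real.pi / 3)) := by
  have hπ : 0 < Real.pi := Real.pi_pos
  have h4 : 0 < 4 * Real.pi * τ := by positivity
  rw [Real.log_rpow h4, show 4 * Real.pi * τ = (2 * Real.pi / 3) * (6 * τ) by ring,
    Real.log_mul (by positivity) (by positivity)]
  ring

/-- **The arithmetic of Theorem A**: from `∫ R u ≥ 12`, `G = ∫ |∇f|² u ≥ 0`, the EE(3,4)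
consequence `log V + log A − ∫ f u ≤ 2 log(1 + G/12)` and `log A + 2 log(6τ) = −2 log(2π/3)`,
conclude `log V − 2 log(2π/3) − 2 ≤ τ ∫ R u + τ G + ∫ f u − 4`. [folklore] -/
theorem floor_of_moments {τ V A IR IG IF : ℝ} (hτ : 0 < τ) (hIR : 12 ≤ IR) (hIG : 0 ≤ IG)
    (hEE : Real.log V + Real.log A - IF ≤ 2 * Real.log (1 + IG / 12))
    (hA : Real.log A + 2 * Real.log (6 * τ) = -(2 * Real.log (2 * Real.pi / 3))) :
    Real.log V - 2 * Real.log (2 * Real.pi / 3) - 2 ≤ τ * IR + τ * IG + IF - 4 := by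
  have h1 := entropyEnergy_oneVariable hτ hIG
  have h2 : τ * 12 ≤ τ * IR := mul_le_mul_of_nonneg_left hIR hτ.le
  linarith

/-! ## `Ric ≥ c g ⇒ R ≥ 4c` in dimension four -/

/-- **`Ric ≥ c·g` forces `R ≥ 4c` in dimension 4** (Riemannian `g`): `R = tr_g Ric = Σᵢ Ric(bᵢ, bᵢ)`
in a `g_x`-orthonormal basis (`exists_basis_isOrthonormalFrame`,
`trace_eq_sum_of_isOrthonormalFrame`; O'Neill 1983, Ch. 3, Def. 3.53). [folklore] -/
theorem scalarCurvature_ge_four_mul_of_ricci_ge {M : Type*} [TopologicalSpace M]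
    [ChartedSpace (EuclideanSpace ℝ (Fin 4)) M] [IsManifold (𝓡 4) ∞ M]
    (g : PseudoRiemannianMetric (𝓡 4) ∞ (EuclideanSpace ℝ (Fin 4))
      (TangentSpace (𝓡 4) : M → Type _))
    [g.HasLeviCivita] (hg : g.IsRiemannian) {c : ℝ} {x : M}
    (hRic : ∀ v : TangentSpace (𝓡 4) x, c * g.val x v v ≤ g.ricci x v v) :
    4 * c ≤ g.scalarCurvature x := by
  obtain ⟨b, hb⟩ := g.exists_basis_isOrthonormalFrame (x := x) (fun v hv ↦ hg x v hv)
    (finrank_euclideanSpace_fin (𝕜 := ℝ) (n := 4))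
  have hsum : g.scalarCurvature x = ∑ i, g.ricci x (b i) (b i) :=
    g.trace_eq_sum_of_isOrthonormalFrame b hb (g.ricci x)
  have hterm : ∀ i, c ≤ g.ricci x (b i) (b i) := fun i ↦ by
    have h := hRic (b i)
    rwa [hb.1 i, mul_one] at h
  calc 4 * c = ∑ _i : Fin 4, c := by
        rw [Finset.sum_const, Finset.card_univ, Fintype.card_fin, nsmul_eq_mul]; norm_num
    _ ≤ ∑ i, g.ricci x (b i) (b i) := Finset.sum_le_sum fun i _ ↦ hterm i
    _ = g.scalarCurvature x := hsum.symm

end EntropyVolume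

open EntropyVolume

/-! ## The stub -/

/-- **STUB `stub_entropyVolume_of_entropyEnergy` of line `curvature-dimension-entropy-floor`
(EE(3,4) ⇒ Theorem A).** Assume the entropy–energy inequality EE(3,4) on closed connected
Riemannian 4-manifolds with `Ric ≥ 3g`: for smooth `w` with `∫ w² dV = Vol`,
`(1/Vol)∫ w² log w² dV ≤ 2 log(1 + ∫|∇w|² dV/(3 Vol))`. Then on every such manifold, for every
`τ > 0` and smooth `f` with `∫ (4πτ)⁻² e^{-f} dV = 1`:
`log Vol − 2 log(2π/3) − 2 ≤ ∫ [τ(R + |∇f|²) + f − 4](4πτ)⁻² e^{-f} dV`.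
Proof: apply EE(3,4) to `w = √(Vol·(4πτ)⁻²) e^{-f/2}` (`∫ w² = Vol`, `|∇w|² = ¼ w² |∇f|²`,
`log w² = log Vol − 2 log(4πτ) − f`), use `R ≥ 12` (`scalarCurvature_ge_four_mul_of_ricci_ge`),
split the Bochner integrals of the continuous integrands on the compact manifold, and finish with
`floor_of_moments` (the one-variable inequality `τG − 2 log(1 + G/12) ≥ 2 − 12τ + 2 log(6τ)` and
`−2 log(4πτ) + 2 log(6τ) = −2 log(2π/3)`). Equality for Einstein metrics `Ric = 3g` at `τ = 1/6`
and constant `f` (`≡ log Vol − 2 log(2π/3)`). [folklore] -/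
theorem stub_entropyVolume_of_entropyEnergy :
    (∀ (M : Type) [TopologicalSpace M] [T2Space M] [SecondCountableTopology M]
      [ChartedSpace (EuclideanSpace ℝ (Fin 4)) M] [IsManifold (𝓡 4) ∞ M] [CompactSpace M] [T3Space M]
      [MeasurableSpace M] [BorelSpace M] [ConnectedSpace M]
      (g : PseudoRiemannianMetric (𝓡 4) ∞ (EuclideanSpace ℝ (Fin 4)) (TangentSpace (𝓡 4) : M → Type _))
      [g.HasLeviCivita] (hg : g.IsRiemannian),
      (∀ (x : M) (v : TangentSpace (𝓡 4) x), 3 * g.val x v v ≤ g.ricci x v v) →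
      ∀ w : M → ℝ, ContMDiff (𝓡 4) 𝓘(ℝ, ℝ) ∞ w →
        ∫ x, w x ^ 2 ∂(riemannianMeasure (g.toContMDiffRiemannianMetric hg))
          = (riemannianMeasure (g.toContMDiffRiemannianMetric hg) Set.univ).toReal →
        (∫ x, w x ^ 2 * Real.log (w x ^ 2) ∂(riemannianMeasure (g.toContMDiffRiemannianMetric hg)))
          / (riemannianMeasure (g.toContMDiffRiemannianMetric hg) Set.univ).toReal ≤
        2 * Real.log (1 + (∫ x, g.gradSq w x ∂(riemannianMeasure (g.toContMDiffRiemannianMetric hg)))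
            / (3 * (riemannianMeasure (g.toContMDiffRiemannianMetric hg) Set.univ).toReal))) →
    ∀ (M : Type) [TopologicalSpace M] [T2Space M] [SecondCountableTopology M]
      [ChartedSpace (EuclideanSpace ℝ (Fin 4)) M] [IsManifold (𝓡 4) ∞ M] [CompactSpace M] [T3Space M]
      [MeasurableSpace M] [BorelSpace M] [ConnectedSpace M]
      (g : PseudoRiemannianMetric (𝓡 4) ∞ (EuclideanSpace ℝ (Fin 4)) (TangentSpace (𝓡 4) : M → Type _))
      [g.HasLeviCivita] (hg : g.IsRiemannian),
      (∀ (x : M) (v : TangentSpace (𝓡 4) x), 3 * g.val x v v ≤ g.ricci x v v) →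
      ∀ τ : ℝ, 0 < τ → ∀ f : M → ℝ, ContMDiff (𝓡 4) 𝓘(ℝ, ℝ) ∞ f →
        ∫ x, (4 * Real.pi * τ) ^ (-(4 : ℝ) / 2) * Real.exp (-f x)
            ∂(riemannianMeasure (g.toContMDiffRiemannianMetric hg)) = 1 →
        Real.log ((riemannianMeasure (g.toContMDiffRiemannianMetric hg) Set.univ).toReal)
            - 2 * Real.log (2 * Real.pi / 3) - 2 ≤
          ∫ x, (τ * (g.scalarCurvature x + g.gradSq f x) + f x - 4) *
            ((4 * Real.pi * τ) ^ (-(4 : ℝ) / 2) * Real.exp (-f x))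
            ∂(riemannianMeasure (g.toContMDiffRiemannianMetric hg)) := by
  intro hEE M _ _ _ _ _ _ _ _ _ _ g _ hg hRic τ hτ f hf hnorm
  -- notation: the measure `μ = dV_g`, the volume `V`, the constant `A = (4πτ)⁻²`
  set μ : Measure M := riemannianMeasure (g.toContMDiffRiemannianMetric hg) with hμ
  set V : ℝ := (μ Set.univ).toReal with hV
  set A : ℝ := (4 * Real.pi * τ) ^ (-(4 : ℝ) / 2) with hA
  haveI : IsFiniteMeasure μ := isFiniteMeasure_riemannianMeasure _
  have hVpos : 0 < V := by
    refine ENNReal.toReal_pos ?_ (measure_ne_top μ _)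
    exact (riemannianVolume_pos_of_isOpen (g.toContMDiffRiemannianMetric hg) isOpen_univ
      univ_nonempty).ne'
  have hApos : 0 < A := Real.rpow_pos_of_pos (by positivity) _
  -- the density `u = A e^{-f}`
  set u : M → ℝ := fun x ↦ A * Real.exp (-f x) with hu
  have hupos : ∀ x, 0 < u x := fun x ↦ mul_pos hApos (Real.exp_pos _)
  have hnorm' : ∫ x, u x ∂μ = 1 := hnorm
  -- continuity and integrability of the integrands
  have hfc : Continuous f := hf.continuous
  have huc : Continuous u := continuous_const.mul (Real.continuous_exp.comp hfc.neg)
  have hRc : Continuous g.scalarCurvature :=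
    (PseudoRiemannianMetric.contMDiff_scalarCurvature g).continuous
  have hGc : Continuous (g.gradSq f) := (contMDiff_gradSq g hf).continuous
  have hint : ∀ {F : M → ℝ}, Continuous F → Integrable F μ := fun hF ↦
    integrable_of_continuous (g.toContMDiffRiemannianMetric hg) hF
  have hu_int : Integrable u μ := hint huc
  have hRu : Integrable (fun x ↦ g.scalarCurvature x * u x) μ := hint (hRc.mul huc)
  have hGu : Integrable (fun x ↦ g.gradSq f x * u x) μ := hint (hGc.mul huc)
  have hfu : Integrable (fun x ↦ f x * u x) μ := hint (hfc.mul huc)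
  -- `R ≥ 12`, hence `∫ R u ≥ 12`; and `∫ |∇f|² u ≥ 0`
  have hR12 : ∀ x, 12 ≤ g.scalarCurvature x := fun x ↦ by
    have h := scalarCurvature_ge_four_mul_of_ricci_ge g hg (c := 3) (x := x) (hRic x)
    linarith
  have hIR : 12 ≤ ∫ x, g.scalarCurvature x * u x ∂μ := by
    have h1 : ∫ x, 12 * u x ∂μ ≤ ∫ x, g.scalarCurvature x * u x ∂μ :=
      integral_mono (hu_int.const_mul 12) hRu fun x ↦
        mul_le_mul_of_nonneg_right (hR12 x) (hupos x).le
    rwa [integral_const_mul, hnorm', mul_one] at h1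
  have hIG : 0 ≤ ∫ x, g.gradSq f x * u x ∂μ :=
    integral_nonneg fun x ↦ mul_nonneg (g.gradSq_nonneg hg f x) (hupos x).le
  -- the test function `w = √(V A) e^{-f/2}` of EE(3,4)
  set c : ℝ := Real.sqrt (V * A) with hc
  have hc2 : c ^ 2 = V * A := Real.sq_sqrt (by positivity)
  have hexp2 : ∀ s : ℝ, Real.exp (-s / 2) ^ 2 = Real.exp (-s) := fun s ↦ by
    rw [sq, ← Real.exp_add]
    congr 1
    ring
  set w : M → ℝ := fun x ↦ c * Real.exp (-f x / 2) with hw_def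
  have hζ : ContDiff ℝ ∞ (fun s : ℝ ↦ c * Real.exp (-s / 2)) :=
    contDiff_const.mul (Real.contDiff_exp.comp (contDiff_neg.div_const 2))
  have hw : ContMDiff (𝓡 4) 𝓘(ℝ, ℝ) ∞ w := hζ.comp_contMDiff hf
  have hw2pt : ∀ x, w x ^ 2 = V * u x := fun x ↦ by
    simp only [hw_def, hu]
    rw [mul_pow, hc2, hexp2]
    ring
  have hw2 : ∫ x, w x ^ 2 ∂μ = V := by
    simp_rw [hw2pt]
    rw [integral_const_mul, hnorm', mul_one]
  -- `w² log w² = V ((log V + log A) u − f u)`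
  have hwlog : ∀ x, w x ^ 2 * Real.log (w x ^ 2) =
      V * ((Real.log V + Real.log A) * u x - f x * u x) := fun x ↦ by
    rw [hw2pt]
    have hl : Real.log (V * u x) = Real.log V + Real.log A - f x := by
      simp only [hu]
      rw [Real.log_mul hVpos.ne' (mul_pos hApos (Real.exp_pos _)).ne',
        Real.log_mul hApos.ne' (Real.exp_pos _).ne', Real.log_exp]
      ring
    rw [hl]
    ring
  have hIwlog : ∫ x, w x ^ 2 * Real.log (w x ^ 2) ∂μ =
      V * ((Real.log V + Real.log A) - ∫ x, f x * u x ∂μ) := by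
    simp_rw [hwlog]
    rw [integral_const_mul, integral_sub (hu_int.const_mul _) hfu, integral_const_mul, hnorm',
      mul_one]
  -- `|∇w|² = ¼ V u |∇f|²`
  have hgradw : ∀ x, g.gradSq w x = V / 4 * (g.gradSq f x * u x) := fun x ↦ by
    have h1 : HasDerivAt (fun s : ℝ ↦ -s / 2) (-1 / 2) (f x) := by
      simpa using ((hasDerivAt_id (f x)).neg.div_const (2 : ℝ))
    have hh : HasDerivAt (fun s : ℝ ↦ c * Real.exp (-s / 2))
        (c * (Real.exp (-f x / 2) * (-1 / 2))) (f x) := (h1.exp).const_mul c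
    have hφ : MDifferentiableAt (𝓡 4) 𝓘(ℝ, ℝ) f x := hf.mdifferentiableAt (by simp)
    have h2 : g.gradSq w x = (c * (Real.exp (-f x / 2) * (-1 / 2))) ^ 2 * g.gradSq f x :=
      g.gradSq_real_comp hh hφ
    rw [h2, show (c * (Real.exp (-f x / 2) * (-1 / 2))) ^ 2 =
      c ^ 2 * Real.exp (-f x / 2) ^ 2 / 4 by ring, hc2, hexp2]
    simp only [hu]
    ring
  have hIgw : ∫ x, g.gradSq w x ∂μ = V / 4 * ∫ x, g.gradSq f x * u x ∂μ := by
    simp_rw [hgradw]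
    rw [integral_const_mul]
  -- EE(3,4) for `w`
  have hE : (∫ x, w x ^ 2 * Real.log (w x ^ 2) ∂μ) / V ≤
      2 * Real.log (1 + (∫ x, g.gradSq w x ∂μ) / (3 * V)) := hEE M g hg hRic w hw hw2
  rw [hIwlog, hIgw] at hE
  have hE' : Real.log V + Real.log A - ∫ x, f x * u x ∂μ ≤
      2 * Real.log (1 + (∫ x, g.gradSq f x * u x ∂μ) / 12) := by
    have h1 : V * ((Real.log V + Real.log A) - ∫ x, f x * u x ∂μ) / V =
        Real.log V + Real.log A - ∫ x, f x * u x ∂μ := by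
      field_simp
    have h2 : V / 4 * (∫ x, g.gradSq f x * u x ∂μ) / (3 * V) =
        (∫ x, g.gradSq f x * u x ∂μ) / 12 := by
      field_simp
      ring
    rwa [h1, h2] at hE
  -- split the entropy integral
  have hsplit : ∫ x, (τ * (g.scalarCurvature x + g.gradSq f x) + f x - 4) * (A * Real.exp (-f x)) ∂μ
      = τ * (∫ x, g.scalarCurvature x * u x ∂μ) + τ * (∫ x, g.gradSq f x * u x ∂μ)
        + (∫ x, f x * u x ∂μ) - 4 := by
    have hpt :
        (fun x ↦ (τ * (g.scalarCurvature x + g.gradSq f x) + f x - 4) * (A * Real.exp (-f x))) =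
          fun x ↦ τ * (g.scalarCurvature x * u x) + τ * (g.gradSq f x * u x) + f x * u x
            - 4 * u x := by
      funext x
      simp only [hu]
      ring
    have i1 : Integrable (fun x ↦ τ * (g.scalarCurvature x * u x)) μ := hRu.const_mul τ
    have i2 : Integrable (fun x ↦ τ * (g.gradSq f x * u x)) μ := hGu.const_mul τ
    have i12 : Integrable (fun x ↦ τ * (g.scalarCurvature x * u x) + τ * (g.gradSq f x * u x)) μ :=
      i1.add i2
    have i123 : Integrable
        (fun x ↦ τ * (g.scalarCurvature x * u x) + τ * (g.gradSq f x * u x) + f x * u x) μ :=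
      i12.add hfu
    have i4 : Integrable (fun x ↦ 4 * u x) μ := hu_int.const_mul 4
    rw [hpt, integral_sub i123 i4, integral_add i12 hfu, integral_add i1 i2, integral_const_mul,
      integral_const_mul, integral_const_mul, hnorm', mul_one]
  rw [hsplit]
  have hlogA : Real.log A + 2 * Real.log (6 * τ) = -(2 * Real.log (2 * Real.pi / 3)) :=
    log_normaliser_add hτ
  exact floor_of_moments hτ hIR hIG hE' hlogA

end Summit.SmoothPoincare4.SmoothPoincare4.Theorems

end
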